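import Literature.NumberTheory.EllipticCurves.OrdinaryReductionTorsionLineProofs
import Literature.NumberTheory.EllipticCurves.HasseWeilGoodReductionFrobeniusProofs
import Literature.NumberTheory.EllipticCurves.GeomPointReduction
import Summits.BirchSwinnertonDyer.BirchSwinnertonDyer.Theorems.FrobeniusUnitRootEigenvalue
import Summits.BirchSwinnertonDyer.BirchSwinnertonDyer.Theorems.OrdinaryReductionCounts
import HarnessLib

/-!
# The Frobenius EIGENVALUE on `E[p^k]` modulo the kernel of reduction at a good ordinary place `v ∣ p`

Cell `bsd-print-cf2`, seat `bsd-line-cf2-p1-w2` g5; ROUTE-FREE helper toward crux stmt-BirchSwinnertonDyer-20368 (brick F-A of the discharge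
road of `stub_finLoc_two`, `Cruxes/SplitBadTwoRankOneOfFacts/TURNKEY-20368-finLoc-w2g5.md`). THEOREMS ONLY (no definition, no named fact,
no `sorry`); closes nothing by itself; BSD is not advanced by any of this; no summit statement is proved here.

`exists_goodReductionHom_frobenius_eigenvalue`: for `W/K` (number field), `v ∣ p` of good ORDINARY reduction, an arithmetic Frobenius
`σ_v ∈ Γ_{K_v}` at the prime `𝔐` of `\bar 𝓞_v` and the `q_v`-Frobenius `φ_v` of `k̄_v`, the reduction map `f : E(K̄) → Ẽ_v(k̄_v)`
(built as in `Literature/…/OrdinaryReductionFrobeniusHomProofs`: `f = ι_r ∘ red ∘ Φ ∘ pointsMap`) has (S) `Γ_{K_v}`-stable kernel,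
(F) `f (res σ_v • a) = φ_v • f a`, (K) `#(ker f ∩ E[p]) = p`, and **(E)** for every `k ≥ 1` an integer `u` with `p ∤ u`,
`p^k ∣ u² − a_v u + q_v` and `f (res σ_v • a) = u • f a` on `E[p^k]` — `σ_v` acts on `E[p^k]/X ≅ f(E[p^k]) = MO~[p^k]` (cyclic of order
`p^k`, `OrdinaryReductionCounts` + `FrobeniusUnitRootEigenvalue` §1) by the unit root of `X² − a_vX + q_v` to precision `p^k` (Manin's
relation, `FrobeniusUnitRootEigenvalue` §2). References: Greenberg LNM 1716 §2 pp. 62–63; Greenberg 1991 §2; Serre 1972 §1.11; Silverman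
*AEC* V.2.3.1, V.3.1, VII.2.1; Mazur, Invent. Math. 18 (1972) §4.
-/

noncomputable section

open scoped Classical NNReal NumberField AddSubgroup
open NumberField IsDedekindDomain Polynomial

namespace Summit.BirchSwinnertonDyer.BirchSwinnertonDyer.Theorems.OrdinaryFrobenius

open _root_.WeierstrassCurve Literature.NumberTheory.EllipticCurves Literature.NumberTheory.GaloisRepresentations Field
  IsDedekindDomain.HeightOneSpectrum

set_option linter.dupNamespace false
set_option autoImplicit false

-- one long construction (local model, two transports, residue embedding, counts): above the default budget
set_option maxHeartbeats 800000 in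
/-- **The reduction map at a good ordinary `v ∣ p` with its Frobenius EIGENVALUE on `E[p^k]`.** `W/K` elliptic over a number field,
`v ∣ p` of good ordinary reduction, `σ_v ∈ Γ_{K_v}` an arithmetic Frobenius at the prime `𝔐` of `\bar 𝓞_v`, `φ_v` the `q_v`-Frobenius of
`k̄_v`. There is a homomorphism `f : E(K̄) → Ẽ_v(k̄_v)` with: (S) `ker f` stable under `Γ_{K_v}`; (F) `f (res σ_v • a) = φ_v • f a`;
(K) `#(ker f ∩ E[p]) = p`; (E) for every `k ≥ 1` an integer `u`, `p ∤ u`, `p^k ∣ u² − a_v u + q_v`, with `f (res σ_v • a) = u • f a` on `E[p^k]`.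
[cite: GreenbergLNM1716, §2 pp. 62–63 (Frobenius acts on Ẽ[p^∞] through the unit root)] [cite: SerreInventiones1972, §1.11 Prop. 11 (proof)]
[cite: SilvermanAEC2009, Thm. V.2.3.1(b), Prop. VII.2.1] -/
theorem exists_goodReductionHom_frobenius_eigenvalue {K : Type} [Field K] [NumberField K]
    (W : WeierstrassCurve K) [W.IsElliptic] (p : ℕ) [hp : Fact p.Prime]
    (v : HeightOneSpectrum (𝓞 K)) (hpv : (p : 𝓞 K) ∈ v.asIdeal) (hgood : W.HasGoodReductionAt v)
    (hord : ¬ ((p : ℤ) ∣ W.frobeniusTraceAt v))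
    {𝔐 : Ideal v.localAbsIntegers} (h𝔐 : 𝔐 ∈ v.localPrimesAbove)
    {σ : absoluteGaloisGroup (v.adicCompletion K)}
    (hσ : IsArithFrobAt (v.adicCompletionIntegers K) σ 𝔐)
    {φ : absoluteGaloisGroup (IsLocalRing.ResidueField (v.adicCompletionIntegers K))}
    (hφ : ∀ x : AlgebraicClosure (IsLocalRing.ResidueField (v.adicCompletionIntegers K)),
      φ • x = x ^ Nat.card (IsLocalRing.ResidueField (v.adicCompletionIntegers K))) :
    ∃ f : geomPoints W →+ geomPoints (W.reductionAt v),
      (∀ (τ : absoluteGaloisGroup (v.adicCompletion K)) (a : geomPoints W),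
          f a = 0 → f (absGaloisRestrict K (v.adicCompletion K) τ • a) = 0) ∧
      (∀ a : geomPoints W, f (absGaloisRestrict K (v.adicCompletion K) σ • a) = φ • f a) ∧
      Nat.card ↥(f.ker ⊓ geomTorsion W p) = p ∧
      ∀ k : ℕ, 0 < k → ∃ u : ℤ, ¬ ((p : ℤ) ∣ u) ∧
        ((p : ℤ) ^ k ∣ u ^ 2 - W.frobeniusTraceAt v * u + Nat.card (IsLocalRing.ResidueField (v.adicCompletionIntegers K))) ∧
        ∀ a ∈ (geomPoints W)[(p ^ k : ℕ)], f (absGaloisRestrict K (v.adicCompletion K) σ • a) = u • f a := by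
  /- the local good-reduction setup and the `k_w`-valued reduction map `f₀` -/
  obtain ⟨w, hw, φO, Φ₀, hX, hφO, hΔO, hΦ₀⟩ := exists_goodReduction_localModel W v hgood
  set MO : WeierstrassCurve w.valuationSubring := (W.localMinimalIntegralModel v).map φO with hMOdef
  -- notation: `L = K̄_v`, `O = 𝒪_w`, `MO` the `𝒪_w`-model, `red` its reduction homomorphism
  have hvO : w.Integers w.valuationSubring := Valuation.valuationSubring.integers w
  set f₀ : geomPoints W →+ (MO.map
      (IsLocalRing.residue w.valuationSubring)).toAffine.Point :=
    (goodReductionHom MO hvO hΔO).comp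
      (((Affine.Point.congrEquiv hX).toAddMonoidHom.comp Φ₀.toAddMonoidHom).comp
      (pointsMap W (v.adicCompletion K))) with hf₀def
  have hf₀ : ∀ a : geomPoints W,
      f₀ a = goodReductionHom MO hvO hΔO
        (Affine.Point.congrEquiv hX (Φ₀ (pointsMap W (v.adicCompletion K) a))) := fun _ ↦ rfl
  obtain ⟨hstab₀, hinv₀, hker₀⟩ :=
    goodReduction_reduction_line W p v hpv hgood hord hw hΔO hX Φ₀ hΦ₀ f₀ hf₀
  /- the residue map `r : 𝒪_w → k̄_v` and the induced embedding `rbar : k_w ↪ k̄_v` -/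
  obtain ⟨r, hr, hrO, hrσ⟩ := exists_residueMap hw h𝔐
  let e : w.valuationSubring →+* w.integer :=
    { toFun := fun a ↦ ⟨(a : AlgebraicClosure (v.adicCompletion K)), (Valuation.mem_integer_iff w _).mpr
        ((Valuation.mem_valuationSubring_iff w _).mp a.2)⟩
      map_one' := Subtype.ext rfl
      map_mul' := fun _ _ ↦ Subtype.ext rfl
      map_zero' := Subtype.ext rfl
      map_add' := fun _ _ ↦ Subtype.ext rfl }
  have he : ∀ a : w.valuationSubring, ((e a : w.integer) : AlgebraicClosure (v.adicCompletion K)) =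
      (a : AlgebraicClosure (v.adicCompletion K)) := fun _ ↦ rfl
  set r' : w.valuationSubring →+* AlgebraicClosure (IsLocalRing.ResidueField (v.adicCompletionIntegers K)) := r.comp e with hr'def
  have hr'0 : ∀ a : w.valuationSubring, r' a = 0 ↔ w (a : AlgebraicClosure (v.adicCompletion K)) < 1 := fun a ↦ by
    rw [hr'def, RingHom.comp_apply, hr, he]
  haveI : IsLocalHom r' := by
    refine ⟨fun a ha ↦ ?_⟩
    rw [hvO.isUnit_iff_valuation_eq_one]
    have hle : w (a : AlgebraicClosure (v.adicCompletion K)) ≤ 1 := hvO.map_le_one a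
    rcases hle.lt_or_eq with hlt | heq
    · exact absurd ((hr'0 a).mpr hlt) ha.ne_zero
    · exact heq
  set rbar : IsLocalRing.ResidueField w.valuationSubring →+* AlgebraicClosure (IsLocalRing.ResidueField (v.adicCompletionIntegers K)) :=
    IsLocalRing.ResidueField.lift r' with hrbardef
  have hrbar : ∀ a : w.valuationSubring, rbar (IsLocalRing.residue w.valuationSubring a) = r' a := fun a ↦
    IsLocalRing.ResidueField.lift_residue_apply r' a
  /- the reduced curve over `k̄_v` is `Ẽ_v ⊗ k̄_v` -/
  set Vt : WeierstrassCurve (AlgebraicClosure (IsLocalRing.ResidueField (v.adicCompletionIntegers K))) := (W.reductionAt v).baseChange (AlgebraicClosure (IsLocalRing.ResidueField (v.adicCompletionIntegers K))) with hVtdef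
  have hEv : W.reductionAt v = (W.localMinimalIntegralModel v).map
      (IsLocalRing.residue (v.adicCompletionIntegers K)) := rfl
  have hcoef : ∀ a : v.adicCompletionIntegers K,
      rbar (IsLocalRing.residue w.valuationSubring (φO a)) =
        algebraMap (IsLocalRing.ResidueField (v.adicCompletionIntegers K)) (AlgebraicClosure (IsLocalRing.ResidueField (v.adicCompletionIntegers K))) (IsLocalRing.residue _ a) := by
    intro a
    have ha : w (algebraMap (v.adicCompletion K) (AlgebraicClosure (v.adicCompletion K))
        (algebraMap (v.adicCompletionIntegers K) (v.adicCompletion K) a)) ≤ 1 :=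
      (spectralValuation_algebraMap_le_one_iff hw _).mpr a.2
    rw [hrbar, hr'def, RingHom.comp_apply]
    have hea : e (φO a) = ⟨_, ha⟩ := Subtype.ext (by rw [he]; exact hφO a)
    rw [hea]
    exact hrO a ha
  have hVt : (MO.map (IsLocalRing.residue w.valuationSubring)).map rbar = Vt := by
    rw [hVtdef, hEv, WeierstrassCurve.map_map, WeierstrassCurve.map_map, baseChange,
      WeierstrassCurve.map_map]
    ext <;> simp only [WeierstrassCurve.map_a₁, WeierstrassCurve.map_a₂, WeierstrassCurve.map_a₃,
      WeierstrassCurve.map_a₄, WeierstrassCurve.map_a₆, RingHom.comp_apply] <;> exact hcoef _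
  /- the map `f = ι_r ∘ f₀` -/
  set ι : (MO.map (IsLocalRing.residue w.valuationSubring)).toAffine.Point →+
      Vt.toAffine.Point :=
    (Affine.Point.congrEquiv hVt).toAddMonoidHom.comp
      ((MO.map (IsLocalRing.residue w.valuationSubring)).mapPointHom rbar)
    with hιdef
  have hιinj : Function.Injective ι :=
    (Affine.Point.congrEquiv hVt).injective.comp (mapPointHom_injective _ rbar)
  have hι0 : ∀ P, ι P = 0 ↔ P = 0 := fun P ↦ by
    rw [← map_zero ι]; exact hιinj.eq_iff
  -- (F): Frobenius equivariance, on coordinates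
  have hF : ∀ a : geomPoints W, ι (f₀ (absGaloisRestrict K (v.adicCompletion K) σ • a)) =
      φ • (show geomPoints (W.reductionAt v) from ι (f₀ a)) := by
    intro a
    obtain ⟨σE, hσE⟩ : ∃ σE : AlgebraicClosure (v.adicCompletion K) →ₐ[v.adicCompletion K]
        AlgebraicClosure (v.adicCompletion K),
        σE = ((absoluteGaloisGroup.toAlgEquiv (v.adicCompletion K) σ :
          AlgebraicClosure (v.adicCompletion K) ≃ₐ[v.adicCompletion K] AlgebraicClosure (v.adicCompletion K)) :
            AlgebraicClosure (v.adicCompletion K) →ₐ[v.adicCompletion K] AlgebraicClosure (v.adicCompletion K)) :=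
      ⟨_, rfl⟩
    obtain ⟨φk, hφk⟩ : ∃ φk : AlgebraicClosure (IsLocalRing.ResidueField (v.adicCompletionIntegers K)) →ₐ[(IsLocalRing.ResidueField (v.adicCompletionIntegers K))] AlgebraicClosure (IsLocalRing.ResidueField (v.adicCompletionIntegers K)),
        φk = ((absoluteGaloisGroup.toAlgEquiv (IsLocalRing.ResidueField (v.adicCompletionIntegers K)) φ : AlgebraicClosure (IsLocalRing.ResidueField (v.adicCompletionIntegers K)) ≃ₐ[(IsLocalRing.ResidueField (v.adicCompletionIntegers K))] AlgebraicClosure (IsLocalRing.ResidueField (v.adicCompletionIntegers K))) :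
          AlgebraicClosure (IsLocalRing.ResidueField (v.adicCompletionIntegers K)) →ₐ[(IsLocalRing.ResidueField (v.adicCompletionIntegers K))] AlgebraicClosure (IsLocalRing.ResidueField (v.adicCompletionIntegers K))) := ⟨_, rfl⟩
    have hσEz : ∀ z, σE z = σ • z := fun z ↦ by rw [hσE]; rfl
    have hφkz : ∀ z, φk z = z ^ Nat.card (IsLocalRing.ResidueField (v.adicCompletionIntegers K)) := fun z ↦ by rw [hφk, ← hφ z]; rfl
    have hσw : ∀ z, w (σE z) = w z := fun z ↦ by rw [hσEz]; exact spectralValuation_smul hw σ z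
    have hφact : ∀ Q : geomPoints (W.reductionAt v), φ • Q = Affine.Point.map φk Q := fun Q ↦ by
      rw [hφk]; rfl
    change ι (f₀ (absGaloisRestrict K (v.adicCompletion K) σ • a)) =
      φ • (show geomPoints (W.reductionAt v) from ι (f₀ a))
    rw [hφact]
    change _ = Affine.Point.map φk (ι (f₀ a))
    have h1 : f₀ (absGaloisRestrict K (v.adicCompletion K) σ • a) =
        goodReductionHom MO hvO hΔO (Affine.Point.congrEquiv hX (Affine.Point.map σE
          (Φ₀ (pointsMap W (v.adicCompletion K) a)))) := by
      rw [hf₀, ← resGal_eq_absGaloisRestrict, pointsMap_smul, hΦ₀, hσE]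
    rw [h1, hf₀]
    -- the computation on an integral affine point
    have key : ∀ (x₁ y₁ : AlgebraicClosure (v.adicCompletion K)) (hx₁ : w x₁ ≤ 1) (hy₁ : w y₁ ≤ 1)
        (h₁ : (MO.baseChange (AlgebraicClosure (v.adicCompletion K))).toAffine.Nonsingular
          x₁ y₁)
        (h₂ : (MO.baseChange (AlgebraicClosure (v.adicCompletion K))).toAffine.Nonsingular
          (σE x₁) (σE y₁)),
        ι (goodReductionHom MO hvO hΔO (.some (σE x₁) (σE y₁) h₂)) =
          Affine.Point.map φk
            (ι (goodReductionHom MO hvO hΔO (.some x₁ y₁ h₁))) := by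
      intro x₁ y₁ hx₁ hy₁ h₁ h₂
      have hσx₁ : w (σE x₁) ≤ 1 := (hσw x₁).le.trans hx₁
      have hσy₁ : w (σE y₁) ≤ 1 := (hσw y₁).le.trans hy₁
      have hxm : x₁ ∈ w.valuationSubring := (Valuation.mem_valuationSubring_iff w x₁).mpr hx₁
      have hym : y₁ ∈ w.valuationSubring := (Valuation.mem_valuationSubring_iff w y₁).mpr hy₁
      have hσxm : σE x₁ ∈ w.valuationSubring := (Valuation.mem_valuationSubring_iff w _).mpr hσx₁
      have hσym : σE y₁ ∈ w.valuationSubring := (Valuation.mem_valuationSubring_iff w _).mpr hσy₁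
      -- reductions of integral points are the residues of the coordinates
      have red_some : ∀ (x₂ y₂ : AlgebraicClosure (v.adicCompletion K)) (hx₂ : x₂ ∈ w.valuationSubring)
          (hy₂ : y₂ ∈ w.valuationSubring)
          (h₃ : (MO.baseChange (AlgebraicClosure (v.adicCompletion K))).toAffine.Nonsingular
            x₂ y₂),
          ∃ hns, goodReductionHom MO hvO hΔO (.some x₂ y₂ h₃) =
            .some (IsLocalRing.residue w.valuationSubring ⟨x₂, hx₂⟩)
              (IsLocalRing.residue w.valuationSubring ⟨y₂, hy₂⟩) hns := by
        intro x₂ y₂ hx₂ hy₂ h₃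
        have hh : (MO.baseChange (AlgebraicClosure (v.adicCompletion K))).toAffine.Nonsingular
            (algebraMap w.valuationSubring (AlgebraicClosure (v.adicCompletion K)) ⟨x₂, hx₂⟩)
            (algebraMap w.valuationSubring (AlgebraicClosure (v.adicCompletion K)) ⟨y₂, hy₂⟩) := h₃
        have hns := (WeierstrassCurve.hasNonsingularReduction_some_algebraMap_iff hvO.hom_inj hh).mp
          (hasNonsingularReduction_of_isUnit_Δ hvO hΔO _)
        exact ⟨hns, by
          change WeierstrassCurve.reducePoint _ (.some _ _ hh) = _
          exact WeierstrassCurve.reducePoint_some_algebraMap hvO.hom_inj hh hns⟩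
      obtain ⟨hns₁, e₁⟩ := red_some x₁ y₁ hxm hym h₁
      obtain ⟨hns₂, e₂⟩ := red_some (σE x₁) (σE y₁) hσxm hσym h₂
      rw [e₁, e₂, hιdef, AddMonoidHom.comp_apply, AddMonoidHom.comp_apply, mapPointHom_some, mapPointHom_some]
      change Affine.Point.congrEquiv hVt _ = Affine.Point.map φk (Affine.Point.congrEquiv hVt _)
      rw [Affine.Point.congrEquiv_some, Affine.Point.congrEquiv_some, Affine.Point.map_some]
      -- coordinates: `r(σ z) = r(z)^q = φ (r z)`
      have hcoord : ∀ (z : AlgebraicClosure (v.adicCompletion K)) (hz : z ∈ w.valuationSubring)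
          (hσz : σE z ∈ w.valuationSubring),
          rbar (IsLocalRing.residue w.valuationSubring ⟨σE z, hσz⟩) =
            φk (rbar (IsLocalRing.residue w.valuationSubring ⟨z, hz⟩)) := by
        intro z hz hσz
        rw [hrbar, hrbar, hφkz, hr'def, RingHom.comp_apply, RingHom.comp_apply]
        have hz' : w z ≤ 1 := (Valuation.mem_valuationSubring_iff w z).mp hz
        have hσz' : w (σ • ((⟨z, (Valuation.mem_integer_iff w _).mpr hz'⟩ : w.integer) :
            AlgebraicClosure (v.adicCompletion K))) ≤ 1 := by
          change w (σ • z) ≤ 1; rw [← hσEz]; exact (Valuation.mem_valuationSubring_iff w _).mp hσz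
        have := hrσ hσ ⟨z, (Valuation.mem_integer_iff w _).mpr hz'⟩ hσz'
        have hea : e ⟨σE z, hσz⟩ = ⟨σ • ((⟨z, (Valuation.mem_integer_iff w _).mpr hz'⟩ : w.integer) :
            AlgebraicClosure (v.adicCompletion K)), hσz'⟩ := Subtype.ext (by rw [he]; exact hσEz z)
        rw [hea, this]
        rfl
      exact point_some_congr (hcoord x₁ hxm hσxm) (hcoord y₁ hym hσym)
    generalize Φ₀ (pointsMap W (v.adicCompletion K) a) = P
    rcases P with _ | ⟨x, y, h⟩
    · rw [← Affine.Point.zero_def, map_zero, map_zero, map_zero, map_zero, map_zero]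
    · have hc₁ := Affine.Point.congrEquiv_some hX h
      have hc₂ : Affine.Point.congrEquiv hX (Affine.Point.map σE (.some x y h)) = .some (σE x) (σE y)
          (hX ▸ (Affine.baseChange_nonsingular _ σE.injective x y).mpr h) := by
        rw [Affine.Point.map_some]
        exact Affine.Point.congrEquiv_some hX _
      simp only [hc₁, hc₂]
      by_cases hx : w x ≤ 1
      · have h' : (MO.baseChange (AlgebraicClosure (v.adicCompletion K))).toAffine.Nonsingular
            x y := by rw [← hX]; exact h
        exact key x y hx (v_Y_le_one_of_v_X_le_one hvO h'.1 hx) _ _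
      · -- non-integral point: both sides are `O`
        have hx1 : 1 < w x := not_le.mp hx
        have hσx1 : 1 < w (σE x) := (hσw x).symm ▸ hx1
        have e₁ : ∀ (x₂ y₂ : AlgebraicClosure (v.adicCompletion K)) (hx₂ : 1 < w x₂)
            (h₃ : (MO.baseChange (AlgebraicClosure (v.adicCompletion K))).toAffine.Nonsingular
              x₂ y₂), goodReductionHom MO hvO hΔO (.some x₂ y₂ h₃) = 0 :=
          fun x₂ y₂ hx₂ h₃ ↦ WeierstrassCurve.reducePoint_some_of_not_mem h₃ ((not_mem_range_iff hvO).mpr hx₂)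
        simp only [e₁ _ _ hσx1, e₁ _ _ hx1, map_zero]
  -- (S) and (K) as in `goodReduction_reduction_line`, through the injective `ι`
  have hS : ∀ (τ : absoluteGaloisGroup (v.adicCompletion K)) (a : geomPoints W),
      ι (f₀ a) = 0 → ι (f₀ (absGaloisRestrict K (v.adicCompletion K) τ • a)) = 0 := by
    intro τ a ha
    rw [hι0] at ha ⊢
    exact hstab₀ τ a ha
  /- (E) the eigenvalue on `E[p^k]`: counts at the good local model (the `CharP` instances are kept local to this block) -/
  have h5 := fun r ↦ goodReduction_ordinary_counts W p v hpv hgood hord hw hΔO r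
  haveI : CharZero (v.adicCompletion K) :=
    charZero_of_injective_algebraMap (algebraMap K (v.adicCompletion K)).injective
  haveI : CharZero (AlgebraicClosure (v.adicCompletion K)) :=
    charZero_of_injective_algebraMap
      (algebraMap (v.adicCompletion K) (AlgebraicClosure (v.adicCompletion K))).injective
  -- counts: `#E[p^n] = p^{2n}` upstairs, `#MO~[p^n] = p^n` downstairs
  have hp0 : ∀ n : ℕ, p ^ n ≠ 0 := fun n ↦ pow_ne_zero n hp.out.ne_zero
  have hA : ∀ n, Nat.card ((geomPoints W)[(p ^ n : ℕ)]) = p ^ n * p ^ n := fun n ↦ by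
    have h := card_torsionBy_eq_sq (E := W.baseChange (AlgebraicClosure K)) (n := p ^ n) (by exact_mod_cast hp0 n)
    rw [sq] at h
    exact h
  have hcardL : ∀ n, Nat.card ((localPoints W (v.adicCompletion K))[(p ^ n : ℕ)]) = p ^ n * p ^ n := fun n ↦ by
    have h := card_torsionBy_eq_sq (E := W.baseChange (AlgebraicClosure (v.adicCompletion K))) (n := p ^ n)
      (by exact_mod_cast hp0 n)
    rw [sq] at h
    exact h
  have hcardMO : ∀ n, Nat.card
      (((MO.baseChange (AlgebraicClosure (v.adicCompletion K))).toAffine.Point)[(p ^ n : ℕ)]) =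
        p ^ n * p ^ n := fun n ↦ by
    haveI hMOell : MO.IsElliptic := ⟨hΔO⟩
    have h := card_torsionBy_eq_sq (E := MO.baseChange (AlgebraicClosure (v.adicCompletion K)))
      (n := p ^ n) (by exact_mod_cast hp0 n)
    rw [sq] at h
    exact h
  have hsurjred : ∀ n, ∀ y ∈ ((MO.map
      (IsLocalRing.residue w.valuationSubring)).toAffine.Point)[(p ^ n : ℕ)],
      ∃ P ∈ ((MO.baseChange (AlgebraicClosure (v.adicCompletion K))).toAffine.Point)[(p ^ n : ℕ)],
        goodReductionHom MO hvO hΔO P = y := by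
    intro n y hy
    obtain ⟨P, hP, hPy⟩ := (h5 n).2 y (mem_torsionBy_iff.mp hy)
    exact ⟨P, mem_torsionBy_iff.mpr hP, hPy⟩
  have hB : ∀ n, Nat.card (((MO.map
      (IsLocalRing.residue w.valuationSubring)).toAffine.Point)[(p ^ n : ℕ)]) = p ^ n := by
    intro n
    have hmul := TateModule.card_ker_torsionBy_mul_card (goodReductionHom MO hvO hΔO)
      (p ^ n) (hsurjred n)
    have hker : Nat.card (((goodReductionHom MO hvO hΔO).ker)[(p ^ n : ℕ)]) = p ^ n := by
      have h := (h5 n).1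
      rw [← Nat.cast_pow] at h
      exact h
    rw [hker, hcardMO n] at hmul
    exact Nat.eq_of_mul_eq_mul_left (Nat.pos_of_ne_zero (hp0 n)) hmul
  -- every `p^n`-torsion point of `MO(K̄_v)` comes from `E(K̄)[p^n]`
  have hsurjΦ : ∀ n, ∀ P ∈ ((MO.baseChange (AlgebraicClosure (v.adicCompletion K))).toAffine.Point)[(p ^ n : ℕ)],
      ∃ a ∈ (geomPoints W)[(p ^ n : ℕ)], Affine.Point.congrEquiv hX (Φ₀ (pointsMap W (v.adicCompletion K) a)) = P := by
    intro n P hP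
    haveI : Finite ((localPoints W (v.adicCompletion K))[(p ^ n : ℕ)]) :=
      Nat.finite_of_card_ne_zero (by rw [hcardL n]; exact mul_ne_zero (hp0 n) (hp0 n))
    obtain ⟨Q, hQdef⟩ : ∃ Q : localPoints W (v.adicCompletion K), Q = Φ₀.symm ((Affine.Point.congrEquiv hX).symm P) :=
      ⟨_, rfl⟩
    have hQ : Q ∈ (localPoints W (v.adicCompletion K))[(p ^ n : ℕ)] := by
      rw [mem_torsionBy_iff, hQdef, ← map_zsmul, ← map_zsmul, mem_torsionBy_iff.mp hP, map_zero, map_zero]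
    obtain ⟨a, ha, haQ⟩ := exists_mem_torsionBy_eq_of_injective (pointsMap W (v.adicCompletion K))
      (pointsMapOfEmb_injective W (closureEmb (K := K) (v.adicCompletion K))) (p ^ n)
      (le_of_eq (by rw [hcardL n, hA n])) Q hQ
    refine ⟨a, ha, ?_⟩
    rw [haQ, hQdef, AddEquiv.apply_symm_apply, AddEquiv.apply_symm_apply]
  -- torsion is preserved by the Galois action and by `f₀`
  have htorsGal : ∀ (n : ℕ) (g : absoluteGaloisGroup K), ∀ a ∈ (geomPoints W)[(p ^ n : ℕ)],
      g • a ∈ (geomPoints W)[(p ^ n : ℕ)] := by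
    intro n g a ha
    rw [mem_torsionBy_iff] at ha ⊢
    change ((p ^ n : ℕ) : ℤ) • (DistribSMul.toAddMonoidHom (geomPoints W) g) a = 0
    rw [← map_zsmul, ha, map_zero]
  haveI := isElliptic_reductionAt hgood
  -- the map `F = ι ∘ f₀`, as an opaque homomorphism with its pointwise description
  obtain ⟨F, hFdef⟩ : ∃ F : geomPoints W →+ geomPoints (W.reductionAt v), ∀ a, F a = ι (f₀ a) :=
    ⟨show geomPoints W →+ geomPoints (W.reductionAt v) from ι.comp f₀, fun _ ↦ rfl⟩
  have hE : ∀ k : ℕ, 0 < k → ∃ u : ℤ, ¬ ((p : ℤ) ∣ u) ∧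
      ((p : ℤ) ^ k ∣ u ^ 2 - W.frobeniusTraceAt v * u + Nat.card (IsLocalRing.ResidueField (v.adicCompletionIntegers K))) ∧
      ∀ a ∈ (geomPoints W)[(p ^ k : ℕ)],
        F (absGaloisRestrict K (v.adicCompletion K) σ • a) = u • F a := by
    intro k hk
    -- `S = MO~[p^k]`, of order `p^k`, has an element `y₀'` of order `p^k` which generates it
    obtain ⟨S, hSdef⟩ : ∃ S : AddSubgroup (MO.map
        (IsLocalRing.residue w.valuationSubring)).toAffine.Point,
        S = ((MO.map (IsLocalRing.residue w.valuationSubring)).toAffine.Point)[(p ^ k : ℕ)] :=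
      ⟨_, rfl⟩
    have hBS : Nat.card S = p ^ k := by rw [hSdef]; exact hB k
    haveI hSfin : Finite S := Nat.finite_of_card_ne_zero (by rw [hBS]; exact hp0 k)
    have hSk : ∀ y ∈ S, p ^ k • y = 0 := fun y hy ↦ by
      rw [hSdef] at hy
      rw [← natCast_zsmul]; exact mem_torsionBy_iff.mp hy
    have hsmall : ∀ T : Finset (MO.map (IsLocalRing.residue w.valuationSubring)).toAffine.Point,
        (∀ y ∈ T, p ^ (k - 1) • y = 0) → T.card ≤ p ^ (k - 1) := by
      intro T hT
      haveI : Finite ((((MO.map (IsLocalRing.residue w.valuationSubring)).toAffine.Point)[(p ^ (k - 1) : ℕ)])) :=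
        Nat.finite_of_card_ne_zero (by rw [hB (k - 1)]; exact hp0 _)
      have hsub : (↑T : Set (MO.map (IsLocalRing.residue w.valuationSubring)).toAffine.Point) ⊆
          (((((MO.map (IsLocalRing.residue w.valuationSubring)).toAffine.Point)[(p ^ (k - 1) : ℕ)]) :
            AddSubgroup (MO.map (IsLocalRing.residue w.valuationSubring)).toAffine.Point) :
            Set (MO.map (IsLocalRing.residue w.valuationSubring)).toAffine.Point) := by
        intro y hy
        exact mem_torsionBy_iff.mpr (by rw [natCast_zsmul]; exact hT y hy)
      have h1 := Set.ncard_le_ncard hsub (Set.toFinite _)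
      rw [Set.ncard_coe_finset] at h1
      refine h1.trans (le_of_eq ?_)
      rw [← Nat.card_coe_set_eq]
      exact hB (k - 1)
    obtain ⟨y₀', hy₀'S, hord'⟩ := exists_mem_addOrderOf_eq_pow_of_card hp.out hk S hBS hSk hsmall
    have hgen' := forall_mem_exists_zsmul_of_addOrderOf_eq_card S hy₀'S (by rw [hord', hBS])
    -- `y₀' = f₀ a₀` for some `a₀ ∈ E[p^k]`
    obtain ⟨P₀, hP₀, hP₀y⟩ := hsurjred k y₀' (by rw [hSdef] at hy₀'S; exact hy₀'S)
    obtain ⟨a₀, ha₀, ha₀P⟩ := hsurjΦ k P₀ hP₀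
    have hfa₀ : f₀ a₀ = y₀' := by rw [hf₀, ha₀P, hP₀y]
    -- the packet `F(E[p^k])` inside `Ẽ_v(k̄_v)`
    obtain ⟨Sbar, hSbardef⟩ : ∃ Sbar : AddSubgroup (geomPoints (W.reductionAt v)),
        Sbar = AddSubgroup.map F ((geomPoints W)[(p ^ k : ℕ)]) := ⟨_, rfl⟩
    have hgen : ∀ y ∈ Sbar, ∃ m : ℤ, y = m • F a₀ := by
      rw [hSbardef]
      rintro _ ⟨b, hb, rfl⟩
      have hb' : f₀ b ∈ S := by
        rw [hSdef, mem_torsionBy_iff, ← map_zsmul, mem_torsionBy_iff.mp hb, map_zero]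
      obtain ⟨m, hm⟩ := hgen' (f₀ b) hb'
      refine ⟨m, ?_⟩
      rw [hFdef, hFdef, hm, map_zsmul, hfa₀]
      rfl
    have hstab : φ • F a₀ ∈ Sbar := by
      rw [hFdef, ← hF a₀, ← hFdef, hSbardef]
      exact ⟨_, htorsGal k _ a₀ ha₀, rfl⟩
    obtain ⟨u, hu, hdiv⟩ := exists_int_frobenius_smul_eq_of_zmultiples (W.reductionAt v) hφ Sbar hgen hstab
    -- the order of `F a₀` is `p^k`
    have hord₀ : addOrderOf (F a₀) = p ^ k := by
      have h : addOrderOf (ι (f₀ a₀)) = addOrderOf (f₀ a₀) := addOrderOf_injective ι hιinj (f₀ a₀)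
      have h2 : addOrderOf (f₀ a₀) = p ^ k := by rw [hfa₀, hord']
      rw [hFdef]
      exact h.trans h2
    have hmem₀ : F a₀ ∈ Sbar := by rw [hSbardef]; exact ⟨a₀, ha₀, rfl⟩
    refine ⟨u, ?_, ?_, ?_⟩
    · exact not_dvd_of_frobenius_smul_eq (W.reductionAt v) hp.out (hu _ hmem₀)
        (by rw [hord₀]; exact dvd_pow_self p hk.ne') (by rw [hord₀]; exact Nat.pos_of_ne_zero (hp0 k))
    · rw [frobeniusTraceAt_def]
      have h' := hdiv
      rw [hord₀, Nat.cast_pow] at h'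
      exact h'
    · intro a ha
      rw [hFdef, hF a, ← hFdef]
      exact hu _ (by rw [hSbardef]; exact ⟨a, ha, rfl⟩)
  refine ⟨F, ?_, ?_, ?_, hE⟩
  · intro τ a ha
    rw [hFdef] at ha ⊢
    exact hS τ a ha
  · intro a
    rw [hFdef, hFdef]
    exact hF a
  · have hKerF : F.ker = f₀.ker := by
      ext a
      rw [AddMonoidHom.mem_ker, AddMonoidHom.mem_ker, hFdef]
      exact hι0 (f₀ a)
    rw [hKerF]
    exact hker₀

end Summit.BirchSwinnertonDyer.BirchSwinnertonDyer.Theorems.OrdinaryFrobenius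

end
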